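import Mathlib.Tactic
import Mathlib.Dynamics.PeriodicPts.Lemmas
import Mathlib.GroupTheory.Perm.Cycle.Basic

/-!
# Route «KPlusLogSqLaw», crux `TropicalB` (stmt-ValiantsHypothesis-19771) — THE TORUS STAIRCASE LEMMA (the «one-run lemma» of two
# cyclic orders), torus coordinates along a permutation cycle, and the additive piece functional

HONEST FRAMING.  Helper toward the registered stubs `stub_tropThin` / `stub_tropFat` of `Cruxes/TropicalB/Lines/birth.lean` (crux
`Summit.ValiantsHypothesis.ValiantsHypothesis.Theses.KPlusLogSqLaw.TropicalB`, item stmt-ValiantsHypothesis-19771, route KPlusLogSqLaw;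
cell `pub-symmetroid`, seat val-sym-trop-p5 g26, refuter-adjacent lane, 2026-08-29; `--supports … --as helper`).  PURE COMBINATORICS
(no design enters this file): it is the combinatorial engine of the SINGLE-CONTACT LAW (`…TropicalBSingleContact`, via
`…TropicalBActivationCycle`).  Nothing here bounds `TropicalB`, and nothing bears on `WeakLifting`, DoorA26 / DoorA34, `MatrixDescartes`
(stmt-ValiantsHypothesis-18050) or VP ≠ VNP.

THE ONE-RUN LEMMA AND ITS TORUS PICTURE (memo HOME/val-sym-trop-p5/g26/ONE-RUN-g26.md; it was the named remainder of conjecture C2 in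
HOME/val-sym-trop-p5/g25/CONTACT-LAWS-g25.md §2c, located-exhaustive there for `k ≤ 9`).  Two cyclic orders `X`, `Y` on a finite set always
admit a subset `E` (`|E| ≥ 2`) on which `Y` is the reverse of `X` and such that for `X|E`-consecutive `a → b` no point lies strictly inside
both the `X`-arc `(a, b)` and the `Y`-arc `(b, a)` — i.e. the union of the two cycles decomposes into SIMPLE closed walks with ONE `X`-run
and ONE `Y`-run each.  PROOF: give a point `c` the torus coordinates `(t(c), s(c))` = (position along `X`, position along `Y`) from a base
point; a one-run decomposition is exactly a closed south-east STAIRCASE through points of winding `(1, −1)` whose open boxes are empty, and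
such a staircase is obtained from the diagonal «base → base + (period, −period)» by inserting points found inside boxes until all boxes are
empty.  §1 runs this refinement as an INDUCTION ON THE WIDTH of a box for an additive box functional `g`: if `g > 0` on every EMPTY box
between admissible corners then `g > 0` on every box between admissible corners (`staircase_pos`), and one interior `star` point makes the
whole torus positive (`staircase_total_pos`).  The points come in two kinds: `star` points (admissible corners) and plain `common` points,
the latter with their diagonal successor again common (in the application: SHARED columns of two activations, whose successor along both
cycles is the same column) — `star_in_box` walks the diagonal from a common point inside a box to a star point inside the same box.
§2: coordinates `t ↦ (ρ ^ t) a` along the cycle of `a` under a permutation `ρ` of `Fin m` (period `Function.minimalPeriod ρ a`, injective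
below the period, every point of the cycle has a coordinate) — thin wrappers of Mathlib.  §3: the piece functional
`Σ_{i ∈ col '' [lo,hi)} f i − [e ∈ col '' [lo,hi)]·c` is additive under splitting the range (`pieceFun_add`).

[elementary; the packaging is the cell's, no citation exists]
-/

set_option linter.dupNamespace false
set_option autoImplicit false

namespace Summit.ValiantsHypothesis.ValiantsHypothesis.Theorems.KPlusLogSqLaw

namespace SingleContact

/-! ## 1. The abstract staircase lemma (the «one-run lemma» of two cyclic orders, in torus coordinates) -/

section Staircase

variable (NP NQ : ℕ) (common star : ℕ → ℕ → Prop) (g : ℕ → ℕ → ℕ → ℕ → ℤ)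

/-- **A box between admissible corners that contains a common point contains a star point.**  Points are `(t, s)` with
`0 < t < NP`, `0 < s < NQ`; `common` points have injective projections; a common point that is not a `star` has its diagonal
successor `(t+1, s+1)` common or equal to the far corner `(NP, NQ)`.  Corners: `U = (tU, sU)` is the top-left corner `(0, NQ)` or a
star, `W = (tW, sW)` is the bottom-right corner `(NP, 0)` or a star, not both extreme, `tU < tW`, `sW < sU`.  [elementary] -/
theorem star_in_box
    (hint : ∀ t s, common t s → 0 < t ∧ t < NP ∧ 0 < s ∧ s < NQ)
    (hsc : ∀ t s, star t s → common t s)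
    (hinj₁ : ∀ t s s', common t s → common t s' → s = s')
    (hinj₂ : ∀ t t' s, common t s → common t' s → t = t')
    (hdiag : ∀ t s, common t s → ¬ star t s → common (t + 1) (s + 1) ∨ (t + 1 = NP ∧ s + 1 = NQ))
    {tU sU tW sW : ℕ} (hU : (tU = 0 ∧ sU = NQ) ∨ star tU sU) (hW : (tW = NP ∧ sW = 0) ∨ star tW sW)
    (hni : ¬ (tU = 0 ∧ tW = NP)) :
    ∀ k t s, tW - t ≤ k → common t s → tU < t → t < tW → sW < s → s < sU →
      ∃ t' s', star t' s' ∧ tU < t' ∧ t' < tW ∧ sW < s' ∧ s' < sU := by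
  intro k
  induction k with
  | zero =>
    intro t s hk _ _ htW _ _
    omega
  | succ k ih =>
    intro t s hk hc htU htW hsW hsU
    by_cases hs : star t s
    · exact ⟨t, s, hs, htU, htW, hsW, hsU⟩
    rcases hdiag t s hc hs with hc' | ⟨ht1, hs1⟩
    · obtain ⟨_, ht'NP, _, hs'NQ⟩ := hint _ _ hc'
      -- the diagonal successor stays inside the box
      have h1 : t + 1 < tW := by
        rcases Nat.lt_or_ge (t + 1) tW with h | h
        · exact h
        · have heq : t + 1 = tW := by omega
          rcases hW with ⟨hWt, _⟩ | hWs
          · omega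
          · have := hinj₁ tW sW (s + 1) (hsc _ _ hWs) (heq ▸ hc')
            omega
      have h2 : s + 1 < sU := by
        rcases Nat.lt_or_ge (s + 1) sU with h | h
        · exact h
        · have heq : s + 1 = sU := by omega
          rcases hU with ⟨_, hUs⟩ | hUs
          · omega
          · have := hinj₂ tU (t + 1) sU (hsc _ _ hUs) (heq ▸ hc')
            omega
      exact ih (t + 1) (s + 1) (by omega) hc' (by omega) h1 (by omega) h2
    · -- the diagonal successor is the far corner: then the box is the initial one
      exfalso
      have htWNP : tW ≤ NP := by
        rcases hW with ⟨h, _⟩ | h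
        · exact h.le
        · exact (hint _ _ (hsc _ _ h)).2.1.le
      have htW' : tW = NP := by omega
      rcases hU with ⟨hU0, _⟩ | hUs
      · exact hni ⟨hU0, htW'⟩
      · have := hint _ _ (hsc _ _ hUs)
        omega

/-- **STAIRCASE LEMMA** (the «one-run lemma» as an induction): if `g` is additive under splitting a box at a point and positive on every
EMPTY box between admissible corners (not both extreme), then `g` is positive on EVERY box between admissible corners (not both extreme):
split at a star point inside (`star_in_box`) and induct on the width. [elementary; this cell] -/
theorem staircase_pos
    (hint : ∀ t s, common t s → 0 < t ∧ t < NP ∧ 0 < s ∧ s < NQ)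
    (hsc : ∀ t s, star t s → common t s)
    (hinj₁ : ∀ t s s', common t s → common t s' → s = s')
    (hinj₂ : ∀ t t' s, common t s → common t' s → t = t')
    (hdiag : ∀ t s, common t s → ¬ star t s → common (t + 1) (s + 1) ∨ (t + 1 = NP ∧ s + 1 = NQ))
    (hadd : ∀ tU t tW sW s sU, tU ≤ t → t ≤ tW → sW ≤ s → s ≤ sU → tW ≤ NP → sU ≤ NQ →
      g tU tW sW sU = g tU t s sU + g t tW sW s)
    (hbase : ∀ tU sU tW sW, ((tU = 0 ∧ sU = NQ) ∨ star tU sU) → ((tW = NP ∧ sW = 0) ∨ star tW sW) →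
      ¬ (tU = 0 ∧ tW = NP) → tU < tW → sW < sU →
      (∀ t s, common t s → ¬ (tU < t ∧ t < tW ∧ sW < s ∧ s < sU)) → 0 < g tU tW sW sU) :
    ∀ n tU sU tW sW, tW - tU ≤ n → ((tU = 0 ∧ sU = NQ) ∨ star tU sU) → ((tW = NP ∧ sW = 0) ∨ star tW sW) →
      ¬ (tU = 0 ∧ tW = NP) → tU < tW → sW < sU → 0 < g tU tW sW sU := by
  intro n
  induction n with
  | zero =>
    intro tU sU tW sW hn _ _ _ hlt _
    omega
  | succ n ih =>
    intro tU sU tW sW hn hU hW hni htUW hsWU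
    by_cases hbox : ∃ t s, common t s ∧ tU < t ∧ t < tW ∧ sW < s ∧ s < sU
    · obtain ⟨t₀, s₀, hc, h1, h2, h3, h4⟩ := hbox
      obtain ⟨t, s, hs, htU, htW, hsW, hsU⟩ :=
        star_in_box NP NQ common star hint hsc hinj₁ hinj₂ hdiag hU hW hni (tW - t₀) t₀ s₀ le_rfl hc h1 h2 h3 h4
      have htWNP : tW ≤ NP := by
        rcases hW with ⟨h, _⟩ | h
        · exact h.le
        · exact (hint _ _ (hsc _ _ h)).2.1.le
      have hsUNQ : sU ≤ NQ := by
        rcases hU with ⟨_, h⟩ | h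
        · exact h.le
        · exact (hint _ _ (hsc _ _ h)).2.2.2.le
      rw [hadd tU t tW sW s sU htU.le htW.le hsW.le hsU.le htWNP hsUNQ]
      have hpos₁ := ih tU sU t s (by omega) hU (Or.inr hs) (by omega) htU hsU
      have hpos₂ := ih t s tW sW (by omega) (Or.inr hs) hW (by omega) htW hsW
      exact add_pos hpos₁ hpos₂
    · push Not at hbox
      exact hbase tU sU tW sW hU hW hni htUW hsWU fun t s hc h => (hbox t s hc h.1 h.2.1 h.2.2.1).not_gt h.2.2.2

/-- **Corollary: a single interior star point makes the whole torus positive** — `g(0, NP; 0, NQ) = g(0, t'; s', NQ) + g(t', NP; 0, s') > 0`.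
In the application `g` of the whole torus is `0`, so there is NO interior star point. [this cell] -/
theorem staircase_total_pos
    (hint : ∀ t s, common t s → 0 < t ∧ t < NP ∧ 0 < s ∧ s < NQ)
    (hsc : ∀ t s, star t s → common t s)
    (hinj₁ : ∀ t s s', common t s → common t s' → s = s')
    (hinj₂ : ∀ t t' s, common t s → common t' s → t = t')
    (hdiag : ∀ t s, common t s → ¬ star t s → common (t + 1) (s + 1) ∨ (t + 1 = NP ∧ s + 1 = NQ))
    (hadd : ∀ tU t tW sW s sU, tU ≤ t → t ≤ tW → sW ≤ s → s ≤ sU → tW ≤ NP → sU ≤ NQ →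
      g tU tW sW sU = g tU t s sU + g t tW sW s)
    (hbase : ∀ tU sU tW sW, ((tU = 0 ∧ sU = NQ) ∨ star tU sU) → ((tW = NP ∧ sW = 0) ∨ star tW sW) →
      ¬ (tU = 0 ∧ tW = NP) → tU < tW → sW < sU →
      (∀ t s, common t s → ¬ (tU < t ∧ t < tW ∧ sW < s ∧ s < sU)) → 0 < g tU tW sW sU)
    {t' s' : ℕ} (hst : star t' s') : 0 < g 0 NP 0 NQ := by
  obtain ⟨h1, h2, h3, h4⟩ := hint _ _ (hsc _ _ hst)
  rw [hadd 0 t' NP 0 s' NQ (Nat.zero_le _) h2.le (Nat.zero_le _) h4.le le_rfl le_rfl]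
  have hp := staircase_pos NP NQ common star g hint hsc hinj₁ hinj₂ hdiag hadd hbase
  exact add_pos (hp _ 0 NQ t' s' le_rfl (Or.inl ⟨rfl, rfl⟩) (Or.inr hst) (by omega) h1 h4)
    (hp _ t' s' NP 0 le_rfl (Or.inr hst) (Or.inl ⟨rfl, rfl⟩) (by omega) h2 h3)

end Staircase

/-! ## 2. Torus coordinates along one cycle of a permutation: `t ↦ (ρ ^ t) a`, period `minimalPeriod ρ a` -/

section Coordinates

variable {m : ℕ} (ρ : Equiv.Perm (Fin m)) (a : Fin m)

/-- one step along the cycle. [elementary] -/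
theorem pow_succ_apply (t : ℕ) : (ρ ^ (t + 1)) a = ρ ((ρ ^ t) a) := by
  rw [pow_succ', Equiv.Perm.mul_apply]

/-- the period is positive (every point of a permutation of a finite type is periodic). [Mathlib] -/
theorem minimalPeriod_pos : 0 < Function.minimalPeriod ρ a :=
  Function.minimalPeriod_pos_of_mem_periodicPts (ρ.injective.mem_periodicPts a)

/-- after one period the cycle closes. [Mathlib] -/
theorem pow_minimalPeriod_apply : (ρ ^ Function.minimalPeriod ρ a) a = a := by
  rw [← Equiv.Perm.iterate_eq_pow]
  exact Function.iterate_minimalPeriod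

/-- the coordinates `t < minimalPeriod ρ a` name distinct points. [Mathlib] -/
theorem pow_apply_injOn {t t' : ℕ} (ht : t < Function.minimalPeriod ρ a) (ht' : t' < Function.minimalPeriod ρ a)
    (h : (ρ ^ t) a = (ρ ^ t') a) : t = t' := by
  rw [← Equiv.Perm.iterate_eq_pow, ← Equiv.Perm.iterate_eq_pow] at h
  exact (Function.iterate_eq_iterate_iff_of_lt_minimalPeriod ht ht').1 h

/-- every point of the cycle of `a` has a coordinate `t < minimalPeriod ρ a`. [Mathlib] -/
theorem exists_coord {c : Fin m} (h : ρ.SameCycle a c) : ∃ t, t < Function.minimalPeriod ρ a ∧ (ρ ^ t) a = c := by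
  obtain ⟨i, hi⟩ := h.exists_nat_pow_eq
  refine ⟨i % Function.minimalPeriod ρ a, Nat.mod_lt _ (minimalPeriod_pos ρ a), ?_⟩
  rw [← hi, ← Equiv.Perm.iterate_eq_pow, ← Equiv.Perm.iterate_eq_pow]
  exact Function.iterate_mod_minimalPeriod_eq

end Coordinates

/-! ## 3. The piece functional of a coordinate range is additive under splitting -/

section PieceFun

variable {m : ℕ}

/-- `Σ_{i ∈ col '' [lo, hi)} f i − [e ∈ col '' [lo, hi)]·c` splits at any `lo ≤ mid ≤ hi ≤ N` when `col` is injective below `N`. [elementary] -/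
theorem pieceFun_add (col : ℕ → Fin m) (N : ℕ) (hinj : ∀ t t', t < N → t' < N → col t = col t' → t = t')
    (f : Fin m → ℤ) (e : Fin m) (c : ℤ) {lo mid hi : ℕ} (h₁ : lo ≤ mid) (h₂ : mid ≤ hi) (h₃ : hi ≤ N) :
    (∑ i ∈ (Finset.Ico lo hi).image col, f i) - (if e ∈ (Finset.Ico lo hi).image col then c else 0) =
      ((∑ i ∈ (Finset.Ico lo mid).image col, f i) - (if e ∈ (Finset.Ico lo mid).image col then c else 0)) +
      ((∑ i ∈ (Finset.Ico mid hi).image col, f i) - (if e ∈ (Finset.Ico mid hi).image col then c else 0)) := by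
  classical
  have hunion : (Finset.Ico lo hi).image col = (Finset.Ico lo mid).image col ∪ (Finset.Ico mid hi).image col := by
    rw [← Finset.image_union, Finset.Ico_union_Ico_eq_Ico h₁ h₂]
  have hdisj : Disjoint ((Finset.Ico lo mid).image col) ((Finset.Ico mid hi).image col) := by
    rw [Finset.disjoint_left]
    intro i hi₁ hi₂
    rw [Finset.mem_image] at hi₁ hi₂
    obtain ⟨t, ht, rfl⟩ := hi₁
    obtain ⟨t', ht', heq⟩ := hi₂
    rw [Finset.mem_Ico] at ht ht'
    have := hinj t t' (by omega) (by omega) heq.symm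
    omega
  rw [hunion, Finset.sum_union hdisj]
  by_cases he₁ : e ∈ (Finset.Ico lo mid).image col
  · have he₂ : e ∉ (Finset.Ico mid hi).image col := Finset.disjoint_left.mp hdisj he₁
    rw [if_pos (Finset.mem_union_left _ he₁), if_pos he₁, if_neg he₂]
    ring
  · by_cases he₂ : e ∈ (Finset.Ico mid hi).image col
    · rw [if_pos (Finset.mem_union_right _ he₂), if_neg he₁, if_pos he₂]
      ring
    · have he : e ∉ (Finset.Ico lo mid).image col ∪ (Finset.Ico mid hi).image col := by
        rw [Finset.mem_union]; push Not; exact ⟨he₁, he₂⟩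
      rw [if_neg he, if_neg he₁, if_neg he₂]
      ring

end PieceFun

end SingleContact

end Summit.ValiantsHypothesis.ValiantsHypothesis.Theorems.KPlusLogSqLaw
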